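import Mathlib
import Summits.Ventures.PercRepro2.TwoHullMasterPathCoverKey
import Summits.Ventures.PercRepro2.TwoHullMasterPendant

/-!
# The cube cover of a path with a pendant graph at an inner vertex (blind cell PercRepro2,
night-4 g40, 2026-08-29; proofs/NIGHT4-G40.md §14)

Glue an arbitrary graph `G₂` at a vertex `p j ≠ h` of the path (`Glue.IsGluing`; `j = 0`, the mark `l`, is allowed).  The cube
cover of the path (TwoHullMasterPathCoverKey.lean) lifts, with the pendant's colouring as a BLOCK
PARAMETER: in the block of key `i` the pendant vertex is `p (i + 1)`; if `j ≤ i` the pendant never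
meets the hull of `h` (it is «before the key»), if `j ≥ i + 2` it never meets the hull of `l`
(«after the key»), and if `j = i + 1` (AT the key) it is complemented together with the interface
class; for the sentinel blocks the key vertex is `p (k + 1)`.  The hull pairs of the glued graph
are the side pairs with the pendant's pair attached where the vertex lies (g39's
`hullPair_glue_pend`), and the three monotonicity lemmas `pendPair_mono_left`,
`pendPair_eq_of_notMem`, `pendPair_le_swap` carry the block properties over: every block is a
monotone cube block (**`cubeBlock_pend`**), the blocks partition `U`, and
**`cubeCover_path_pendant`** is the cube-cover conjecture on a path decorated at one inner vertex
— the rule «the subtree at the key vertex rides with the interface, every other subtree is free»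
(the tree census of mining/night-4/g40/treecover.py) in the kernel; the blocks and the cover are in
TwoHullMasterPathPendantCover.lean.
-/

namespace Summit.Ventures.PercRepro2

namespace Blocks

open Hull LocRows Path2 Glue Glue2

open scoped Classical

variable {V : Type*}

/-! ## §1 The attached pair -/

/-- `pendPair` is monotone in the side pair. -/
lemma pendPair_mono_left {q₁ q₁' q₂ : Set V × Set V} {c : V} (h : PairLE q₁ q₁') :
    PairLE (pendPair q₁ c q₂) (pendPair q₁' c q₂) := by
  refine ⟨?_, ?_⟩
  · rintro x (hx | ⟨hc, hx⟩)
    · exact Or.inl (h.1 hx)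
    · exact Or.inr ⟨h.1 hc, hx⟩
  · rintro x (hx | ⟨hc, hx⟩)
    · exact Or.inl (h.2 hx)
    · exact Or.inr ⟨h.2 hc, hx⟩

/-- A pendant at a vertex outside the side pair attaches nothing. -/
lemma pendPair_eq_of_notMem {q₁ q₂ : Set V × Set V} {c : V} (h1 : c ∉ q₁.1) (h2 : c ∉ q₁.2) :
    pendPair q₁ c q₂ = q₁ := by
  simp only [pendPair]
  refine Prod.ext ?_ ?_
  · ext x
    simp only [Set.mem_union, Set.mem_setOf_eq]
    exact ⟨fun hx => hx.elim id fun hx' => absurd hx'.1 h1, Or.inl⟩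
  · ext x
    simp only [Set.mem_union, Set.mem_setOf_eq]
    exact ⟨fun hx => hx.elim id fun hx' => absurd hx'.1 h2, Or.inl⟩

/-- The attached pair moves up when the side pair moves up and the pendant is complemented, provided
the vertex is not red on the lower side and not blue on the upper side. -/
lemma pendPair_le_swap {q₁ q₁' q₂ : Set V × Set V} {c : V} (h : PairLE q₁ q₁') (h1 : c ∉ q₁.1)
    (h2 : c ∉ q₁'.2) : PairLE (pendPair q₁ c q₂) (pendPair q₁' c q₂.swap) := by
  refine ⟨?_, ?_⟩
  · rintro x (hx | ⟨hc, _⟩)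
    · exact Or.inl (h.1 hx)
    · exact absurd hc h1
  · rintro x (hx | ⟨hc, _⟩)
    · exact Or.inl (h.2 hx)
    · exact absurd hc h2

/-! ## §2 Membership of a path vertex in the side pairs -/

variable {k : ℕ} {p : Fin (k + 3) → V}

/-- `p v` lies in the red cluster of `p 0` iff the prefix up to `v` is red. -/
lemma mem_hullPair_zero_fst (hp : Function.Injective p) (ζ : Config (Fin (k + 2)))
    (v : Fin (k + 3)) : p v ∈ (hullPair (pathEnds p) ζ (p 0)).1 ↔ Pre ζ true v := by
  simp only [hullPair]
  rw [p_mem_cluster_zero_iff hp, RedPrefix_iff_Pre]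

/-- `p v` lies in the blue cluster of `p 0` iff the prefix up to `v` is blue. -/
lemma mem_hullPair_zero_snd (hp : Function.Injective p) (ζ : Config (Fin (k + 2)))
    (v : Fin (k + 3)) : p v ∈ (hullPair (pathEnds p) ζ (p 0)).2 ↔ Pre ζ false v := by
  simp only [hullPair]
  rw [p_mem_cluster_zero_iff hp, RedPrefix_iff_Pre, Pre_blue_iff]

/-- `p v` lies in the red cluster of `p (k + 2)` iff the suffix from `v` is red. -/
lemma mem_hullPair_last_fst (hp : Function.Injective p) (ζ : Config (Fin (k + 2)))
    (v : Fin (k + 3)) :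
    p v ∈ (hullPair (pathEnds p) ζ (p (Fin.last (k + 2)))).1 ↔ Suf ζ true v := by
  simp only [hullPair]
  rw [p_mem_cluster_last_iff hp, RedSuffix_iff_Suf]

/-- `p v` lies in the blue cluster of `p (k + 2)` iff the suffix from `v` is blue. -/
lemma mem_hullPair_last_snd (hp : Function.Injective p) (ζ : Config (Fin (k + 2)))
    (v : Fin (k + 3)) :
    p v ∈ (hullPair (pathEnds p) ζ (p (Fin.last (k + 2)))).2 ↔ Suf ζ false v := by
  simp only [hullPair]
  rw [p_mem_cluster_last_iff hp, RedSuffix_iff_Suf, Suf_blue_iff]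

/-- The vertex right after the key: a prefix run reaching it fixes the interface bit. -/
lemma pre_keyWord_succ {i : Fin k} {ε : keyCube i → Bool} {b : Bool} {v : Fin (k + 3)}
    (hv : v.val = i.val + 1) (hP : Pre (keyWord i ε) b v) : ε (Sum.inr false) = b := by
  have := hP (idx i) (by rw [idx_val]; omega)
  rwa [keyWord_eq ε rfl] at this

/-- The vertex right after the key: a suffix run reaching it fixes the interface bit. -/
lemma suf_keyWord_succ {i : Fin k} {ε : keyCube i → Bool} {b : Bool} {v : Fin (k + 3)}
    (hv : v.val = i.val + 1) (hS : Suf (keyWord i ε) b v) : (!ε (Sum.inr false)) = b := by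
  have := hS (idxS i) (by rw [idxS_val]; omega)
  rwa [keyWord_seg ε (by rw [idxS_val]; omega) (by rw [idxS_val]; omega)] at this

/-- The key vertex of the sentinel: a prefix run reaching `p (k + 1)` fixes the bit. -/
lemma pre_sentWord_succ {ε : Unit → Bool} {b : Bool} {v : Fin (k + 3)} (hv : v.val = k + 1)
    (hP : Pre (sentWord (k := k) ε) b v) : ε () = b := by
  have := hP 0 (by rw [Fin.val_zero]; omega)
  rwa [sentWord_le ε (by rw [Fin.val_zero]; omega)] at this

/-- The key vertex of the sentinel: a suffix run reaching `p (k + 1)` fixes the bit. -/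
lemma suf_sentWord_succ {ε : Unit → Bool} {b : Bool} {v : Fin (k + 3)} (hv : v.val = k + 1)
    (hS : Suf (sentWord (k := k) ε) b v) : (!ε ()) = b := by
  have := hS (idxL : Fin (k + 2)) (by rw [idxL_val]; omega)
  rwa [sentWord_last ε (by rw [idxL_val]; omega)] at this

/-! ## §3 The blocks of the decorated path -/

variable {E₂ : Type*} {ends₂ : E₂ → Sym2 V}

/-- The block `b` is merged with the pendant at `p j`: `j` is the key vertex of `b`. -/
def mergedAt (j : Fin (k + 3)) : Fin k ⊕ Unit → Prop
  | Sum.inl i => j.val = i.val + 1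
  | Sum.inr _ => j.val = k + 1

/-- The interface bit of a block point. -/
def sbit : (b : Fin k ⊕ Unit) → (pathι b → Bool) → Bool
  | Sum.inl _, ε => ε (Sum.inr false)
  | Sum.inr _, ε => ε ()

/-- The blocks of the decorated path: the path block `b` with the pendant's colouring `c` as a
parameter, complemented together with the interface bit when the pendant sits at the key vertex. -/
noncomputable def pendPt (j : Fin (k + 3)) (b : (Fin k ⊕ Unit) × Config E₂) (ε : pathι b.1 → Bool) :
    Config (Fin (k + 2) ⊕ E₂) :=
  pair (pathPt b.1 ε) (if mergedAt j b.1 ∧ sbit b.1 ε = true then blue b.2 else b.2)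

/-- The first side of a block point. -/
lemma pendPt_inl (j : Fin (k + 3)) (b : (Fin k ⊕ Unit) × Config E₂) (ε : pathι b.1 → Bool) :
    pendPt j b ε ∘ Sum.inl = pathPt b.1 ε := rfl

/-- The second side of a block point. -/
lemma pendPt_inr (j : Fin (k + 3)) (b : (Fin k ⊕ Unit) × Config E₂) (ε : pathι b.1 → Bool) :
    pendPt j b ε ∘ Sum.inr =
      if mergedAt j b.1 ∧ sbit b.1 ε = true then blue b.2 else b.2 := rfl

/-- The points of the path blocks are non-constant words. -/
lemma pathPt_not_isConst (b : Fin k ⊕ Unit) (ε : pathι b → Bool) : ¬ IsConst (pathPt b ε) := by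
  cases b with
  | inl i => exact keyWord_not_isConst i ε
  | inr u => exact sentWord_not_isConst ε

/-- The path blocks are mirrored by the colour swap. -/
lemma pathPt_cubeNot (b : Fin k ⊕ Unit) (ε : pathι b → Bool) :
    pathPt b (cubeNot ε) = blue (pathPt b ε) := by
  cases b with
  | inl i => exact keyWord_cubeNot i ε
  | inr u => exact sentWord_cubeNot ε

/-- The interface bit of the antipode. -/
lemma sbit_cubeNot (b : Fin k ⊕ Unit) (ε : pathι b → Bool) : sbit b (cubeNot ε) = !sbit b ε := by
  cases b <;> rfl

variable {V₁ V₂ : Set V}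

/-- A point of a merged block lies in `U` of the glued graph iff its path side is non-constant. -/
lemma pendPt_mem (hp : Function.Injective p) (j : Fin (k + 3))
    (hg : IsGluing (pathEnds p) ends₂ (p j) V₁ V₂) (hl : p 0 ∈ V₁) (hh : p (Fin.last (k + 2)) ∈ V₁)
    (hj : j ≠ Fin.last (k + 2)) (b : (Fin k ⊕ Unit) × Config E₂) (ε : pathι b.1 → Bool) :
    p (Fin.last (k + 2)) ∉ hull (Glue.glue (pathEnds p) ends₂) (pendPt j b ε) (p 0) := by
  rw [notMem_hull_glue_iff hg hl hh (fun h => hj (hp h).symm), pendPt_inl,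
    last_notMem_hull_iff hp]
  exact pathPt_not_isConst b.1 ε

/-- The hull pair of `l` in the glued graph at a block point. -/
lemma hullPair_pendPt_l (j : Fin (k + 3)) (hg : IsGluing (pathEnds p) ends₂ (p j) V₁ V₂)
    (hl : p 0 ∈ V₁) (b : (Fin k ⊕ Unit) × Config E₂) (ε : pathι b.1 → Bool) :
    hullPair (Glue.glue (pathEnds p) ends₂) (pendPt j b ε) (p 0) =
      pendPair (hullPair (pathEnds p) (pathPt b.1 ε) (p 0)) (p j)
        (hullPair ends₂ (if mergedAt j b.1 ∧ sbit b.1 ε = true then blue b.2 else b.2) (p j)) := by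
  rw [hullPair_glue_pend hg hl, pendPt_inl, pendPt_inr]

/-- The hull pair of `h` in the glued graph at a block point. -/
lemma hullPair_pendPt_h (j : Fin (k + 3)) (hg : IsGluing (pathEnds p) ends₂ (p j) V₁ V₂)
    (hh : p (Fin.last (k + 2)) ∈ V₁) (b : (Fin k ⊕ Unit) × Config E₂) (ε : pathι b.1 → Bool) :
    hullPair (Glue.glue (pathEnds p) ends₂) (pendPt j b ε) (p (Fin.last (k + 2))) =
      pendPair (hullPair (pathEnds p) (pathPt b.1 ε) (p (Fin.last (k + 2)))) (p j)
        (hullPair ends₂ (if mergedAt j b.1 ∧ sbit b.1 ε = true then blue b.2 else b.2) (p j)) := by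
  rw [hullPair_glue_pend hg hh, pendPt_inl, pendPt_inr]

/-- A merged block is mirrored by the colour swap. -/
lemma pendPt_cubeNot_merged (j : Fin (k + 3)) (b : (Fin k ⊕ Unit) × Config E₂)
    (hm : mergedAt j b.1) (ε : pathι b.1 → Bool) :
    pendPt j b (cubeNot ε) = blue (pendPt j b ε) := by
  funext e
  cases e with
  | inl e =>
    have := congrFun (pathPt_cubeNot b.1 ε) e
    exact this
  | inr e =>
    simp only [pendPt, pair, Sum.elim_inr, sbit_cubeNot, hm, true_and]
    cases sbit b.1 ε <;> simp [blue]

/-- The first side of a non-merged block point is the pendant colouring itself. -/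
lemma pendPt_inr_of_not_merged (j : Fin (k + 3)) (b : (Fin k ⊕ Unit) × Config E₂)
    (hm : ¬ mergedAt j b.1) (ε : pathι b.1 → Bool) : pendPt j b ε ∘ Sum.inr = b.2 := by
  rw [pendPt_inr]
  simp [hm]

end Blocks

end Summit.Ventures.PercRepro2
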